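import Summits.Schanuel.Schanuel.Theorems.ZilberEacGraphSimpleTopRow
import Summits.Schanuel.Schanuel.Theorems.ZilberEacFibreCurveDensity
import HarnessLib

/-!
# The equimodular class, XXX: examples for THEOREM EB — `{x₁ = c·x₀^d, x₀(y₀² + y₀ + 1) = 1}`

HONEST FRAMING.  Cell `pub-schanuel` (Zilber's Exponential-Algebraic Closedness, case ladder;
host summit Schanuel), seat 2, gen 24.  Instances of file XXIX (`unprojectedDense_graph_simpleTopRow`):
the fibre polynomial `P = x₀ y₀² + x₀ y₀ + x₀ - 1` has `y₀`-degrees `2, 1, 0` (two distinct POSITIVE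
`y₀`-degrees — outside gen 23's `y₀`-linear and binomial classes), rows `x₀, x₀, x₀ - 1` of degree
`N = 1`, top row `T = X² + X + 1` (simple roots `e^{±2πi/3}`, nonzero), and extreme rows
`q_0 = x₀ - 1 ≠ c·x₀ = c·q_2`.  Hence for every `c ≠ 0`, `d ≥ 2` the surface
`{x₁ = c·x₀^d, x₀(y₀² + y₀ + 1) = 1}` is in Mantova–Masser's case and has Zariski-dense exponential
points (**`unprojectedDensityQuestion_monomialGraph_cyclotomicFibre`**); e.g.
**`unprojectedDense_cubicGraph_cyclotomicFibre`**: `{x₁ = x₀³, x₀ y₀² + x₀ y₀ + x₀ = 1}` — a member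
of gen 18's residual equimodular class (`|θ| = 1`, `p₂ = 0`, `Re(i³) = 0`) with two branches
`y₀ → e^{±2πi/3}`, neither of which is decided alone by the tree (the logarithm of ONE algebraic branch
is not known there to be transcendental), but whose product `(x₀ - 1)/x₀` is rational and
non-constant.  The reciprocal-type member `{x₁ = x₀³, x₀ y₀² + y₀ + x₀ = 0}` (`q_0 = q_2`) stays
OPEN, as do Mantova–Masser's question (PLMS 2024 §1 p. 5) in general and EC(3,2); NOT Schanuel's
conjecture (neither used nor implied; EAC ⇏ SC).
-/

noncomputable section

open Complex MvPolynomial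
open Literature.NumberTheory.Transcendental Literature.ModelTheory.Zilber
open Literature.ModelTheory.ExponentialFields

set_option linter.dupNamespace false

namespace Summit.Schanuel.Schanuel.Theorems

/-- The fibre polynomial `x₀ y₀² + x₀ y₀ + x₀ - 1` in rows: `Q = x₀·t² + x₀·t + (x₀ - 1)`. -/
theorem eval_cyclotomicFibreP (x y : ℂ) :
    MvPolynomial.eval ![x, y] (X 0 * X 1 ^ 2 + X 0 * X 1 + X 0 - 1 : MvPolynomial (Fin 2) ℂ) =
      ((Polynomial.C Polynomial.X * Polynomial.X ^ 2 + Polynomial.C Polynomial.X * Polynomial.X +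
        Polynomial.C (Polynomial.X - 1) : Polynomial (Polynomial ℂ)).map
          (Polynomial.evalRingHom x)).eval y := by
  simp
  ring

/-- `x₀ y₀² + x₀ y₀ + x₀ - 1` is irreducible (degree one in `x₀` over `ℂ[y₀]` with coefficient
`y₀² + y₀ + 1 ≠ 0` and unit constant term `-1`). -/
theorem irreducible_cyclotomicFibreP :
    Irreducible (X 0 * X 1 ^ 2 + X 0 * X 1 + X 0 - 1 : MvPolynomial (Fin 2) ℂ) := by
  have himage : MvPolynomial.finSuccEquiv ℂ 1 (X 0 * X 1 ^ 2 + X 0 * X 1 + X 0 - 1) =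
      Polynomial.C (X 0 ^ 2 + X 0 + 1 : MvPolynomial (Fin 1) ℂ) * Polynomial.X + Polynomial.C (-1) := by
    rw [map_sub, map_add, map_add, map_mul, map_mul, map_pow, map_one, MvPolynomial.finSuccEquiv_X_zero,
      show (X 1 : MvPolynomial (Fin 2) ℂ) = X (Fin.succ 0) from rfl, MvPolynomial.finSuccEquiv_X_succ,
      map_add, map_add, map_pow, map_one, map_neg, map_one]
    ring
  have ha : (X 0 ^ 2 + X 0 + 1 : MvPolynomial (Fin 1) ℂ) ≠ 0 := by
    intro h
    have := congrArg (MvPolynomial.eval fun _ => (0 : ℂ)) h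
    simp at this
  have hirr := irreducible_C_mul_X_add_C_of_isUnit (R := MvPolynomial (Fin 1) ℂ) ha
    (isUnit_one.neg)
  rw [← himage] at hirr
  exact (MulEquiv.irreducible_iff (MvPolynomial.finSuccEquiv ℂ 1).toMulEquiv).1 hirr

/-- The rows of `Q = x₀·t² + x₀·t + (x₀ - 1)`. -/
theorem coeff_cyclotomicFibreQ (j : ℕ) :
    (Polynomial.C Polynomial.X * Polynomial.X ^ 2 + Polynomial.C Polynomial.X * Polynomial.X +
        Polynomial.C (Polynomial.X - 1) : Polynomial (Polynomial ℂ)).coeff j =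
      if j = 2 then Polynomial.X else if j = 1 then Polynomial.X
        else if j = 0 then Polynomial.X - 1 else 0 := by
  simp only [Polynomial.coeff_add, Polynomial.coeff_C_mul, Polynomial.coeff_X_pow, Polynomial.coeff_X,
    Polynomial.coeff_C]
  rcases j with _ | _ | _ | j <;> simp

/-- **`{x₁ = c·x₀^d, x₀(y₀² + y₀ + 1) = 1}` is in Mantova–Masser's case and DENSE** for all `d ≥ 2`,
`c ≠ 0` (THEOREM EB with top row `X² + X + 1` and extreme rows `x₀ - 1`, `x₀`).
[cite: MantovaMasser2023, §1 Further remarks, p. 5 (the question, open in general)] (new) -/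
theorem unprojectedDensityQuestion_monomialGraph_cyclotomicFibre {c : ℂ} (hc : c ≠ 0) {d : ℕ}
    (hd : 2 ≤ d) :
    MMCaseDimPiOneFree {w : Fin 2 ⊕ Fin 2 → ℂ |
      w (Sum.inl 1) = c * w (Sum.inl 0) ^ d ∧
        w (Sum.inl 0) * w (Sum.inr 0) ^ 2 + w (Sum.inl 0) * w (Sum.inr 0) + w (Sum.inl 0) - 1 = 0} ∧
    UnprojectedDense {w : Fin 2 ⊕ Fin 2 → ℂ |
      w (Sum.inl 1) = c * w (Sum.inl 0) ^ d ∧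
        w (Sum.inl 0) * w (Sum.inr 0) ^ 2 + w (Sum.inl 0) * w (Sum.inr 0) + w (Sum.inl 0) - 1 = 0} := by
  classical
  set P : MvPolynomial (Fin 2) ℂ := X 0 * X 1 ^ 2 + X 0 * X 1 + X 0 - 1 with hPdef
  set p : Polynomial ℂ := Polynomial.C c * Polynomial.X ^ d with hpdef
  have hset : {w : Fin 2 ⊕ Fin 2 → ℂ |
      w (Sum.inl 1) = c * w (Sum.inl 0) ^ d ∧
        w (Sum.inl 0) * w (Sum.inr 0) ^ 2 + w (Sum.inl 0) * w (Sum.inr 0) + w (Sum.inl 0) - 1 = 0} =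
      {w : Fin 2 ⊕ Fin 2 → ℂ | w (Sum.inl 1) = p.eval (w (Sum.inl 0)) ∧
        MvPolynomial.eval ![w (Sum.inl 0), w (Sum.inr 0)] P = 0} := by
    ext w
    simp only [Set.mem_setOf_eq, hpdef, hPdef, Polynomial.eval_mul, Polynomial.eval_C, Polynomial.eval_pow,
      Polynomial.eval_X, MvPolynomial.eval_X, map_sub, map_add, map_mul, map_pow, map_one,
      Matrix.cons_val_zero, Matrix.cons_val_one]
  rw [hset]
  have hpd : p.natDegree = d := by rw [hpdef, Polynomial.natDegree_C_mul_X_pow d c hc]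
  have hd' : 2 ≤ p.natDegree := by rwa [hpd]
  have hirr : Irreducible P := irreducible_cyclotomicFibreP
  refine ⟨mmCase_fibreCurveSurface p hd' hirr ?_, ?_⟩
  · -- infinitely many `t` with a nonzero fibre point: every `t ∉ {0, 1}`
    refine ((Set.finite_singleton (1 : ℂ)).insert (0 : ℂ)).infinite_compl.mono ?_
    intro t ht
    simp only [Set.mem_compl_iff, Set.mem_insert_iff, Set.mem_singleton_iff, not_or] at ht
    -- a root `y` of `t y² + t y + (t - 1)`
    set q : Polynomial ℂ := Polynomial.C t * Polynomial.X ^ 2 + Polynomial.C t * Polynomial.X +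
      Polynomial.C (t - 1) with hq
    have hqdeg : 0 < q.degree := by
      rw [hq, Polynomial.degree_quadratic ht.1]; norm_num
    obtain ⟨y, hy⟩ := Complex.exists_root hqdeg
    have hy' : t * y ^ 2 + t * y + t - 1 = 0 := by
      have := hy.eq_zero
      simp only [hq, Polynomial.eval_add, Polynomial.eval_mul, Polynomial.eval_C, Polynomial.eval_pow,
        Polynomial.eval_X] at this
      linear_combination this
    refine ⟨y, ?_, ?_⟩
    · rintro rfl
      apply ht.2
      linear_combination hy'
    · simp only [hPdef, map_sub, map_add, map_mul, map_pow, MvPolynomial.eval_X, map_one,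
        Matrix.cons_val_zero, Matrix.cons_val_one]
      exact hy'
  · set Q : Polynomial (Polynomial ℂ) := Polynomial.C Polynomial.X * Polynomial.X ^ 2 +
      Polynomial.C Polynomial.X * Polynomial.X + Polynomial.C (Polynomial.X - 1) with hQ
    set T : Polynomial ℂ := Polynomial.X ^ 2 + Polynomial.X + 1 with hTdef
    have hQdeg : Q.natDegree = 2 := by
      rw [hQ]; exact Polynomial.natDegree_quadratic Polynomial.X_ne_zero
    have hT2 : T = Polynomial.C 1 * Polynomial.X ^ 2 + Polynomial.C 1 * Polynomial.X + Polynomial.C 1 := by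
      rw [hTdef, map_one]; ring
    have hTdeg : T.natDegree = Q.natDegree := by
      rw [hQdeg, hT2]; exact Polynomial.natDegree_quadratic one_ne_zero
    refine unprojectedDense_graph_simpleTopRow Q (fun x y => by rw [hPdef, hQ]; exact eval_cyclotomicFibreP x y)
      hirr 1 (fun j => ?_) T (fun j => ?_) hTdeg ?_ ?_ (fun a => ?_) p hd'
    · rw [hQ, coeff_cyclotomicFibreQ]
      split_ifs
      · exact Polynomial.natDegree_X_le
      · exact Polynomial.natDegree_X_le
      · rw [show (Polynomial.X - 1 : Polynomial ℂ) = Polynomial.X - Polynomial.C 1 by rw [map_one],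
          Polynomial.natDegree_X_sub_C]
      · simp
    · rw [hQ, coeff_cyclotomicFibreQ, hTdef]
      simp only [Polynomial.coeff_add, Polynomial.coeff_X_pow, Polynomial.coeff_X, Polynomial.coeff_one]
      rcases j with _ | _ | _ | j <;> simp [Polynomial.coeff_one]
    · -- `X² + X + 1` is separable: `(4/3)·T - ((2X + 1)/3)·T' = 1`
      rw [Polynomial.separable_def, hTdef]
      have hder : Polynomial.derivative (Polynomial.X ^ 2 + Polynomial.X + 1 : Polynomial ℂ) =
          2 * Polynomial.X + 1 := by
        simp
        norm_num
      rw [hder]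
      refine ⟨Polynomial.C (1 / 3) * 4, -(Polynomial.C (1 / 3)) * (2 * Polynomial.X + 1), ?_⟩
      have e : (Polynomial.C (1 / 3) * 4 * (Polynomial.X ^ 2 + Polynomial.X + 1) +
          -Polynomial.C (1 / 3) * (2 * Polynomial.X + 1) * (2 * Polynomial.X + 1) : Polynomial ℂ) =
            Polynomial.C (1 / 3) * 3 := by
        ring
      rw [e, ← map_ofNat Polynomial.C 3, ← map_mul, show (1 / 3 : ℂ) * OfNat.ofNat 3 = 1 by norm_num,
        map_one]
    · rw [hTdef]; simp
    · rw [hQ, hQdeg, coeff_cyclotomicFibreQ, coeff_cyclotomicFibreQ]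
      simp only [if_true, show (0 : ℕ) ≠ 2 from by norm_num, show (0 : ℕ) ≠ 1 from by norm_num, if_false]
      intro h
      have := congrArg (fun q : Polynomial ℂ => q.coeff 0) h
      simp at this

/-- **`{x₁ = x₀³, x₀ y₀² + x₀ y₀ + x₀ = 1}` has Zariski-dense exponential points** — a member of the
residual equimodular class with two distinct positive `y₀`-degrees and two branches
`y₀ → e^{±2πi/3}`, decided by the all-branches trick.
[cite: MantovaMasser2023, §1 Further remarks, p. 5 (the question, open in general)] (new) -/
theorem unprojectedDense_cubicGraph_cyclotomicFibre :
    UnprojectedDense {w : Fin 2 ⊕ Fin 2 → ℂ |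
      w (Sum.inl 1) = w (Sum.inl 0) ^ 3 ∧
        w (Sum.inl 0) * w (Sum.inr 0) ^ 2 + w (Sum.inl 0) * w (Sum.inr 0) + w (Sum.inl 0) - 1 = 0} := by
  have h := (unprojectedDensityQuestion_monomialGraph_cyclotomicFibre one_ne_zero (by norm_num : 2 ≤ 3)).2
  simpa only [one_mul] using h

end Summit.Schanuel.Schanuel.Theorems
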